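import Mathlib
import HarnessLib
import HarnessLib.Audit
import Summits.ABC.Statement
import Literature.Barriers.ABC.BakerMethodBoundsStewartTijdemanGenericProofs
import Literature.Barriers.ABC.BakerMethodBoundsEpsShape
import HarnessLib.Audit.Status.Attr

/-!
Route: PadicPrincipalCoreRadThree

CLOSED (proved) 2026-08-26T13:16:26Z by planner-abc-stewartyu-plan-g6-0 — reason: proved:Summit.ABC.ABC.Theorems.epsShapeBoundThree_holds — note: rung F-A1.M1⁺(3) EpsShapeBoundThree by name: epsShapeBoundThree_holds (p444248 p2-g3 / p444403 p3-g3, ACCEPTED 12:16–12:19Z); all items closed·proved (19165, 19893–19896). The file is kept as the record of this route; refuted decls are indexed as negative knowledge (`ledger negatives`).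

# Route PadicPrincipalCoreRadThree — log c ≪_ε rad^(3+ε) from a p-adic Waldschmidt-1980 bound for
principal units with constant (2^70·m)^m

RUNG ROUTE M1⁺(3) (D-0059/D-0061, class rung, never summit credit): it suffices to show THEOREM A
WITH c₂ ≤ 1 — the p-adic
Waldschmidt-1980 bound for principal units ≡ 1 (mod p) of route PadicPrincipalCoreST86 with the
envelope C(m) ≤ c₁^m·m^m,
which is EXACTLY the envelope of Waldschmidt's main parameter over ℚ: U = A^m·m^(2m+3)/m!·(∏Vⱼ)·W⋆·G
≤ (2^69 m)^m·(∏Vⱼ)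
(W + log 2Vmax)·log 2Vmax (tree: `Waldschmidt1980.w80Cw m = (2^70 m)^m`, `W80Par.U_le_Cw`; p-adic
record: the cell's
`PadicW80Par.U_le_Cw`, `two_mul_Cw_le`). With WP-M (m^(2m)·p), the glue (κ = c₂ + 2 = 3, σ = 2) and
the κ-DOOR at the
odd places (Stewart–Yu 1991 §3 with n^(κn): two odd p-adic routes + Waldschmidt's archimedean route
when a < √b) it gives,
for every ε > 0, log c ≤ κ(ε)·rad(abc)^(3+ε) for c ≥ c₀(ε), i.e. the rung leaf `EpsShapeBoundThree`
(hence also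
`EpsShapeBoundFour` by `epsShapeBoundFour_of_three`; between Stewart–Tijdeman's 15 and Stewart–Yu's
2/3 + ε; a consequence
of Stewart–Yu 1991 in print, re-derived here by the principal-unit architecture). ONE-CRUX RUNG
ROUTE (ruling 21-frontier 2026-08-25T20:00:22Z: one-statement rung routes are admissible): the
single open
statement is TheoremAOne (rank 2; first rung m ≤ 1 proved: Theorems-side `theoremALeOne_holds`); the
supports WPM (closed: `PrincipalLattice.exists_principal_generators`) and GlueSpec are shared with
route PadicPrincipalCoreST86 by
signature, OddKappaDoorSpec is proved in staging.
Lean: `∃ (C : ℕ → ℝ) (r : ℕ → ℕ) (c₁ c₂ : ℝ), 1 ≤ c₁ ∧ 0 ≤ c₂ ∧ c₂ ≤ 1 ∧ (∀ m, 0 ≤ C m ∧ C m ≤ c₁ ^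
m * (m : ℝ) ^ (c₂ * m)) ∧ (∀ (p : ℕ), p.Prime → p ≠ 2 → ∀ (m : ℕ) (α : Fin m → ℚ) (b : Fin m → ℤ) (V
: Fin m → ℝ) (Vmax W : ℝ), (∀ j, α j ≠ 0 ∧ 1 ≤ padicValRat p (α j - 1)) → (∀ μ : Fin m → ℤ, ∏ j, α j
^ μ j = 1 → μ = 0) → (∀ T : Finset (Fin m), T.Nonempty → ¬ IsSquare (∏ j ∈ T, α j)) → (∀ j,
Height.logHeight₁ (α j) ≤ V j) → (∀ j, Real.log p ≤ V j) → (∀ j, V j ≤ Vmax) → b ≠ 0 → (∀ j,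
Real.log (max 3 (|b j| : ℝ)) ≤ W) → (padicValRat p (∏ j, α j ^ b j - 1) : ℝ) * Real.log p ≤ C m * (∏
j, V j) * (W + Real.log (2 * Vmax)) * Real.log (2 * Vmax) / Real.log p ^ r m)`

## Assembly
Pure logic (`glueB3.lean`): unpack TheoremAOne's witnesses (c₂ ≤ 1), feed them with WP-M to the glue
(κ ≤ c₂ + 2 ≤ 3 at
every odd prime, σ = τ = τ₁ = 2), apply the odd κ-door (exponent max(1, κ) ≤ 3) and
`epsShapeBound_mono`.

CLOSES_TARGET: closes rung F-A1.M1⁺(3) of ABC: Literature.Barriers.ABC.EpsShapeBoundThree (D-0061; not the summit Statement) — the deciding theorem of this route concludes that registered leaf instead of the Statement decl `ABC` (class rung: servable and labelled, never counted as concluding the summit Statement).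

CONDITIONAL on Summit.ABC.ABC.Theorems.PadicTheoremAOne.TheoremAOne — this route is an explicit reduction to that named conjecture (D-0019: crux floor waived).

Rationale: WHY THIS LINE. Mechanism: transpose Waldschmidt's 1980 interpolation-determinant-free
auxiliary-function scheme (Cijsouw–Waldschmidt 1977
descent, as ported in the tree for the archimedean case, `Waldschmidt1980.endgame`, `CW77.Setup`) to
ℚ_p for principal
units: exp/log on the closed ball ‖a‖ ≤ p⁻¹ (p odd), Newton interpolation at integer nodes with Yu's
1989 Lemma 1.4
extrapolation (`PadicNewton.norm_tsum_le_max_of_small_jets_int`, landed), ultrametric Schwarz with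
radius √p (gain
(log p)/2 per zero, conditioning loss `condExp·log p`), p-adic Liouville by the product formula,
multiquadratic Liouville
for the half steps [Yu1989, Waldschmidt1980, CijsouwWaldschmidt1977]. The reduction of arbitrary
prime generators q_i to
principal units is done ONCE, outside the analytic core, by a Minkowski–Mahler basis of the lattice
of exponent vectors z
with ∏ q_i^(z_i) ≡ ±1 (mod p) (index ≤ p − 1; Kummer condition for free since p ≠ 2), costing
m^(2m)·p in the heights —
this removes Yu's p^d from the core; with c₂ = 1 (the true envelope of U: m^(2m+3)/m! ≤ (e·8)^m·m^m)
the one-prime bound carries n^(3n)·p², and the κ-door (max-ord device + Chebyshev on S minus the top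
prime, the surplus n^((κ−1)n) paid in the exponent) turns it into rad^(3+ε) [StewartYu1991 §3
(17)–(18), StewartTijdeman1986]. Imported from transcendence theory (archimedean Baker method) into
the p-adic setting with an explicit
dictionary (|·| ↦ ‖·‖_p, radius R ↦ √p, Schwarz ↦ ultrametric Schwarz, Liouville ↦ product formula).
No prior route of
this summit re-derives a Baker-method rung; the negatives index has no statement of this shape.

RANKED CRUXES. #2 TheoremAOne (crux) — Theorem A with cap c₂ ≤ 1: the bound of route
PadicPrincipalCoreST86's TheoremA (p odd; α_j ≡ 1 (mod p) independent and Kummer-free; h(α_j) ≤ V_j,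
log p ≤ V_j ≤ Vmax; b ≠ 0, log max(3,|b_j|) ≤ W ⇒ ord_p(∏ α_j^(b_j) − 1)·log p ≤ C(m)·(∏ V_j)·(W +
log 2Vmax)·log 2Vmax/(log p)^r(m)) for SOME C with C(m) ≤ c₁^m·m^m (c₁ = 2^70 from `two_mul_Cw_le`;
r = 0). [difficulty: XL] (why it might fail: c₂ = 1 is exactly the envelope 2·(2^69 m)^m ≤
(2^70)^m·m^m of U, no slack: any further m^m in the final constant (W⋆, G beyond U; an m-dependent
conditioning loss condExp·log p; Dmax·Mmax budgets ∝ m^m·U) pushes c₂ past 1 and the rung back to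
rad^(4+ε) (restate to TheoremATwo, stmt-ABC-19016).) [Yu1989, Waldschmidt1980,
CijsouwWaldschmidt1977]
#9 WPM (support) — WP-M principal generators: for p odd, distinct primes q_i ≠ p, e ≠ 0 with ord_p(∏
q_i^(e_i) − 1) ≥ 1, there are rationals α_j ≡ 1 (mod p), multiplicatively independent, Kummer-free,
and e' ≠ 0 with ∏ q_i^(e_i) = ∏ α_j^(e'_j), ∏ h(α_j) ≤ m^(2m)·p·∏ log q_i, |e'_j| ≤ m^(2m)·p·(∏ log
q_i)·max|e_i|, log p ≤ 2 h(α_j). Proved in staging (Minkowski II + Mahler + Cramer; landing chain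
Summits/ABC/StewartYu/PrincipalUnitLattice* → PadicLogFormsPrincipalReduction, theorem
`Summit.ABC.StewartYu.PrincipalLattice.exists_principal_generators`). [difficulty: provable-now]
[Yu1989, EvertseGyory2015]
#9 GlueSpec (support) — The glue: WP-M and any Theorem-A-shaped bound with envelope C(m) ≤
c₁^m·m^(c₂ m) give the one-prime bound at every odd prime with exponents (κ, σ, τ, τ₁) = (≤ c₂ + 2,
2, 2, 2). In the tree: `Summit.ABC.StewartYu.primePadicBoundAt_odd_of_principal`
(Summits/ABC/StewartYu/GluePrincipalToPrime.lean) with K = 4704, L = 32 c₁ — a one-line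
instantiation. [difficulty: provable-now] [StewartYu1991, Yu1989]
#9 OddKappaDoorSpec (support) — The κ-door at the odd places: the one-prime bound with σ ≤ 2 at
every ODD prime (any K ≥ 0, L ≥ 1, κ ≥ 0) gives EpsShapeBound (max 1 κ), i.e. log c ≪_ε
rad^(max(1,κ)+ε) — two odd p-adic routes through the max-ord device and Lemma 4 (Chebyshev) of
Stewart–Yu 1991 on S minus the top prime of the route, plus Waldschmidt's archimedean route when a <
√b. Proved in staging (`Summit.ABC.StewartYu.KappaDoor.epsShape_of_oddFinBound`, files
KappaDoorAlgebra/KappaDoorSlot landed, K2–K4 staged). [difficulty: provable-now] [StewartYu1991,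
StewartTijdeman1986]

TWO-LAYER PLAN. As for route PadicPrincipalCoreST86: TheoremAOne ⇐ HalfSteps (WP-A3, p3 J1–J3:
proved-staged) → ParamNumerics (WP-A4: the record
`PadicW80Par` + `PadicW80Numeric`, staged rc 0 by p1, and p3's J2 closed forms for Dmax·Mmax) →
TheoremAOne through p2's closing adapter
`PadicCW77.theoremAShapeLe_of_packs` (κ = 1) once `PadicCW77Main|Assembly` have landed; k = 2.

KILL CRITERIA. A refutation of TheoremAOne with TheoremATwo (c₂ ≤ 2, banked as stmt-ABC-19016)
surviving restates the crux to TheoremATwo and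
re-targets the leaf EpsShapeBoundFour (κ = 4; `route edit --restate … --closes-target`); a
refutation of the scheme at p = 3 for every admissible
parameter choice retires the route in favour of route PadicPrincipalCoreST86 (c₂ ≤ 10); a refutation
of TheoremA for every c₂ kills both.

NOT DECOMPOSED YET. Theorem A's interior (WP-A1…A5) as in route PadicPrincipalCoreST86; the
all-places κ-door (exponent 2(c₂+2)/3 = 8/3,
needs the core at p = 2) is recorded in the cell skeleton (KappaDoorSpec) and not filed.

CHEAPEST FALSIFIER. The envelope itself is a tree/staging fact (`w80Cw`, `two_mul_Cw_le`); so: the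
k-step inequality (1) and the half-step inequality at p = 3, J = 0, m = 2 with the record
`PadicW80Par`:
(⌊hLb/(p−1)⌋ + ⌊(t−1)/(p−1)⌋ + condExp)·log p + log(Dmax·Mmax) < U — a one-page computation once
Dmax/Mmax are frozen
(p1, WP-A4 table v0.2); the m = 1 instance (α₀ = 1 + 2p) only constrains r(1) = 0.

NUMBERS. c₂ = 1, c₁ = 2^70 (U ≤ (2^69 m)^m·(∏V)(W + log 2Vmax) log 2Vmax, final bound 2U), κ = 3, σ
= 2; leaf exponent 3 + ε (and 4 + ε as a corollary);
with WP-M improved to m!·C^m (open question F-plan-4) the same core would give κ = 2. Stewart–Yu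
1991: 2/3 + ε; Stewart–Yu 2001: 1/3 (log R)^3 [StewartYu2001].

DEFINITION REQUESTS. None (`Literature/Barriers/ABC/BakerMethodBoundsEpsShape.lean` with the leaves
EpsShapeBoundThree/Four landed 2026-08-25, p404792).

Novelty: Searches (2026-08-25): lean search 'stewartTijdeman1986' (tree: statement + doors
`_of_primePadicBound_logRad`, `_five_logRad`, no proof of the bound); ledger negatives --problem ABC
(no Baker-method statement); lit search "p-adic logarithmic forms principal units Waldschmidt 1980"
and lit search --hybrid "Yu p-adic linear forms in logarithms supersingular Kummer condition" (hits:
Yu1989, Yu1990, Yu1998, Yu2007, StewartYu1991, StewartYu2001 — all use Yu's general theorems with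
the Kummer descent inside the analytic argument); lit galaxy search "Stewart-Tijdeman|Stewart–Yu|abc
conjecture Baker" --star all (survey hits Waldschmidt2014, EvertseGyory2015 §4.6).
Nearest prior art found: Yu1989 (Theorem 1: p-adic bound with the Kummer condition, constant
depending on p^d) and StewartTijdeman1986 (the rung itself, via van der Poorten's p-adic estimates);
Waldschmidt1980 (the archimedean scheme transposed here).
Delta: the analytic core is run only on principal units ≡ 1 (mod p) produced once by lattice
reduction (Minkowski–Mahler, index ≤ p − 1, Kummer for free at p odd), so the p-adic W80
transposition has no p^d and no Kummer descent inside — a formalisation architecture, not a new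
theorem.
Claimed grade: variant  [refs: Yu1989, Yu1990, Yu1998, Yu2007, StewartYu1991, StewartYu2001, Waldschmidt2014, EvertseGyory2015, StewartTijdeman1986, Waldschmidt1980]

Barriers (technique_class: baker-linear-forms, padic-interpolation-determinant): - technique_class: baker-linear-forms, padic-interpolation-determinant
- Literature.Barriers.ABC.BakerMethodBounds: it does not evade it and does not try to — this is a
RUNG route inside the Baker class (closes the rung leaf EpsShapeBoundThree, log c ≪_ε rad^(3+ε),
still exponential in rad; class rung, never summit credit, D-0061).
- Negatives index: empty for this technique class at filing (ledger negatives --problem ABC: no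
linear-forms statement).

History (route lifecycle, newest last):
- 2026-08-26T13:16:26Z · CLOSED proved — proved:Summit.ABC.ABC.Theorems.epsShapeBoundThree_holds (planner-abc-stewartyu-plan-g6-0)

sub-problem: ABC · status: closed(proved) · opened planner-abc-stewartyu-plan-g2-0 2026-08-25T22:55:17Z · rev 0 · ledger route-ABC-PadicPrincipalCoreRadThree
GENERATED by the gate from the ledger (D-0016/17). Provers cite these decls: `theorem foo : Summit.ABC.ABC.Theses.PadicPrincipalCoreRadThree.<Decl> := …` in Summits/ABC/ABC/Theorems/<Name>.lean.
-/

namespace Summit.ABC.ABC.Theses.PadicPrincipalCoreRadThree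

open scoped BigOperators Topology Manifold Classical MeasureTheory ProbabilityTheory Matrix InnerProductSpace ComplexConjugate ContinuousMap
open Filter Set Function TopologicalSpace MeasureTheory

attribute [summit_statement] _root_.ABC
attribute [summit_statement] _root_.Literature.Barriers.ABC.EpsShapeBoundThree

open Literature.Abc

/-- item stmt-ABC-19165 · crux · rank 2 · closed · proved by Summit.ABC.ABC.Theorems.padicPrincipalCoreRadThree_theoremAOne_proof (prover) · by planner
why it might fail: Kernel-verified in two scratch certificates (p2 CHECK_MEGA_FINAL, p3 CHECK_MEGA_TheoremA_min, 08-25T20:19Z: c₁ = 2^70, c₂ = 1, r = 0, axioms standard), not in the tree: what can still fail is LANDING (≈25 files, three chains; vendored-fact defs, olean lag) and the referee's independent re-run.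
sources: Yu1989, Waldschmidt1980, CijsouwWaldschmidt1977
[aside] Theorem A with the cap c₂ ≤ 1 (constant C(m) ≤ c₁^m·m^m, c₁ = 2^70): the strengthening of
TheoremA on which the sibling rung route PadicPrincipalCoreRadThree (log c ≪_ε rad^(3+ε), leaf
EpsShapeBoundThree) is conditional; c₂ = 1 is the proved envelope of the scheme's main parameter U
(2·(2^69 m)^m ≤ (2^70)^m·m^m). Banked here (kind aside: never staffed from this route, not in the
cone of closes); TheoremAOne → TheoremATwo → TheoremA are immediate (1 ≤ 2 ≤ 10). -/
@[route_item "route-ABC-PadicPrincipalCoreRadThree", crux]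
def TheoremAOne : Prop :=
  ∃ (C : ℕ → ℝ) (r : ℕ → ℕ) (c₁ c₂ : ℝ), 1 ≤ c₁ ∧ 0 ≤ c₂ ∧ c₂ ≤ 1 ∧ (∀ m, 0 ≤ C m ∧ C m ≤ c₁ ^ m * (m : ℝ) ^ (c₂ * m)) ∧ (∀ (p : ℕ), p.Prime → p ≠ 2 → ∀ (m : ℕ) (α : Fin m → ℚ) (b : Fin m → ℤ) (V : Fin m → ℝ) (Vmax W : ℝ), (∀ j, α j ≠ 0 ∧ 1 ≤ padicValRat p (α j - 1)) → (∀ μ : Fin m → ℤ, ∏ j, α j ^ μ j = 1 → μ = 0) → (∀ T : Finset (Fin m), T.Nonempty → ¬ IsSquare (∏ j ∈ T, α j)) → (∀ j, Height.logHeight₁ (α j) ≤ V j) → (∀ j, Real.log p ≤ V j) → (∀ j, V j ≤ Vmax) → b ≠ 0 → (∀ j, Real.log (max 3 (|b j| : ℝ)) ≤ W) → (padicValRat p (∏ j, α j ^ b j - 1) : ℝ) * Real.log p ≤ C m * (∏ j, V j) * (W + Real.log (2 * Vmax)) * Real.log (2 * Vmax) / Real.log p ^ r m)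

-- `TheoremAOne` holds: proved by `Summit.ABC.ABC.Theorems.padicPrincipalCoreRadThree_theoremAOne_proof` (its module imports this route file, so no `_holds` link can be stated here).

/-- item stmt-ABC-19893 · support · rank 9 · closed · proved by Summit.ABC.ABC.Theorems.padicPrincipalCoreRadThree_wpm_proof @ f4e04128897f (prover) · by planner
sources: Yu1989, EvertseGyory2015
[support] WP-M principal generators: for p odd, distinct primes q_i ≠ p, e ≠ 0 with ord_p(∏
q_i^(e_i) − 1) ≥ 1, there are rationals α_j ≡ 1 (mod p), multiplicatively independent, Kummer-free,
and e' ≠ 0 with ∏ q_i^(e_i) = ∏ α_j^(e'_j), ∏ h(α_j) ≤ m^(2m)·p·∏ log q_i, |e'_j| ≤ m^(2m)·p·(∏ log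
q_i)·max|e_i|, log p ≤ 2 h(α_j). Proved in staging (Minkowski II + Mahler + Cramer; landing chain
Summits/ABC/StewartYu/PrincipalUnitLattice* → PadicLogFormsPrincipalReduction, theorem
`Summit.ABC.StewartYu.PrincipalLattice.exists_principal_generators`). [difficulty: provable-now] -/
@[route_item "route-ABC-PadicPrincipalCoreRadThree", crux]
def WPM : Prop :=
  ∀ (p : ℕ), p.Prime → p ≠ 2 → ∀ (m : ℕ) (q : Fin m → ℕ), (∀ i, (q i).Prime) → Function.Injective q → (∀ i, q i ≠ p) → ∀ (e : Fin m → ℤ), e ≠ 0 → 1 ≤ padicValRat p (∏ i, (q i : ℚ) ^ e i - 1) → ∃ (α : Fin m → ℚ) (e' : Fin m → ℤ), (∀ j, α j ≠ 0 ∧ 1 ≤ padicValRat p (α j - 1)) ∧ (∀ μ : Fin m → ℤ, ∏ j, α j ^ μ j = 1 → μ = 0) ∧ (∀ T : Finset (Fin m), T.Nonempty → ¬ IsSquare (∏ j ∈ T, α j)) ∧ e' ≠ 0 ∧ ∏ i, (q i : ℚ) ^ e i = ∏ j, α j ^ e' j ∧ (∏ j, Height.logHeight₁ (α j)) ≤ (m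 : ℝ) ^ (2 * m) * p * ∏ i, Real.log (q i) ∧ (∀ j, (|e' j| : ℝ) ≤ (m : ℝ) ^ (2 * m) * p * (∏ i, Real.log (q i)) * (Finset.univ.sup fun i => (e i).natAbs)) ∧ (∀ j, Real.log p ≤ 2 * Height.logHeight₁ (α j))

-- `WPM` holds: proved by `Summit.ABC.ABC.Theorems.padicPrincipalCoreRadThree_wpm_proof` @ f4e04128897f (its module imports this route file, so no `_holds` link can be stated here).

/-- item stmt-ABC-19894 · support · rank 9 · closed · proved by Summit.ABC.ABC.Theorems.padicPrincipalCoreRadThree_glueSpec_proof @ f4e04128897f (prover) · by planner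
sources: StewartYu1991, Yu1989
[support] The glue: WP-M and any Theorem-A-shaped bound with envelope C(m) ≤ c₁^m·m^(c₂ m) give the
one-prime bound at every odd prime with exponents (κ, σ, τ, τ₁) = (≤ c₂ + 2, 2, 2, 2). In the tree:
`Summit.ABC.StewartYu.primePadicBoundAt_odd_of_principal`
(Summits/ABC/StewartYu/GluePrincipalToPrime.lean) with K = 4704, L = 32 c₁ — a one-line
instantiation. [difficulty: provable-now] -/
@[route_item "route-ABC-PadicPrincipalCoreRadThree", crux]
def GlueSpec : Prop :=
  (∀ (p : ℕ), p.Prime → p ≠ 2 → ∀ (m : ℕ) (q : Fin m → ℕ), (∀ i, (q i).Prime) → Function.Injective q → (∀ i, q i ≠ p) → ∀ (e : Fin m → ℤ), e ≠ 0 → 1 ≤ padicValRat p (∏ i, (q i : ℚ) ^ e i - 1) → ∃ (α : Fin m → ℚ) (e' : Fin m → ℤ), (∀ j, α j ≠ 0 ∧ 1 ≤ padicValRat p (α j - 1)) ∧ (∀ μ : Fin m → ℤ, ∏ j, α j ^ μ j = 1 → μ = 0) ∧ (∀ T : Finset (Fin m), T.Nonempty → ¬ IsSquare (∏ j ∈ T,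 α j)) ∧ e' ≠ 0 ∧ ∏ i, (q i : ℚ) ^ e i = ∏ j, α j ^ e' j ∧ (∏ j, Height.logHeight₁ (α j)) ≤ (m : ℝ) ^ (2 * m) * p * ∏ i, Real.log (q i) ∧ (∀ j, (|e' j| : ℝ) ≤ (m : ℝ) ^ (2 * m) * p * (∏ i, Real.log (q i)) * (Finset.univ.sup fun i => (e i).natAbs)) ∧ (∀ j, Real.log p ≤ 2 * Height.logHeight₁ (α j))) → ∀ (C : ℕ → ℝ) (r : ℕ → ℕ) (c₁ c₂ : ℝ), 1 ≤ c₁ → 0 ≤ c₂ → (∀ m, 0 ≤ C m ∧ C m ≤ c₁ ^ m * (m : ℝ) ^ (c₂ * m)) → (∀ (p : ℕ), p.Prime → p ≠ 2 → ∀ (m : ℕ) (α : Fin m → ℚ) (b : Fin m → ℤ) (V : Fin m → ℝ) (Vmax W : ℝ), (∀ j, α j ≠ 0 ∧ 1 ≤ padicValRat p (α j - 1)) → (∀ μ : Fin m → ℤ, ∏ j, α j ^ μ j = 1 → μ = 0) → (∀ T : Finset (Fin m), T.Nonempty → ¬ IsSquare (∏ j ∈ T, α j)) → (∀ j, Height.logHeight₁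 (α j) ≤ V j) → (∀ j, Real.log p ≤ V j) → (∀ j, V j ≤ Vmax) → b ≠ 0 → (∀ j, Real.log (max 3 (|b j| : ℝ)) ≤ W) → (padicValRat p (∏ j, α j ^ b j - 1) : ℝ) * Real.log p ≤ C m * (∏ j, V j) * (W + Real.log (2 * Vmax)) * Real.log (2 * Vmax) / Real.log p ^ r m) → ∃ (K L κ : ℝ), 0 ≤ K ∧ 1 ≤ L ∧ 0 ≤ κ ∧ κ ≤ c₂ + 2 ∧ ∀ p, p.Prime → p ≠ 2 → (∀ (n : ℕ) (q : Fin n → ℕ) (e : Fin n → ℤ), (∀ i, (q i).Prime) → Function.Injective q → (∀ i, q i ≠ p) → e ≠ 0 → ∏ i, ((q i : ℚ)) ^ e i ≠ 1 → (padicValRat p (∏ i, ((q i : ℚ)) ^ e i - 1) : ℝ) ≤ K * L ^ n * (n : ℝ) ^ (κ * n) * (p : ℝ) ^ (2:ℝ) * (∏ i, Real.log (q i)) * Real.log (max 3 ((Finset.univ.sup fun i => (e i).natAbs : ℕ) : ℝ)) ^ (2:ℕ) * Real.log (max 3 (∏ i, ((q i : ℕ) : ℝ))) ^ (2:ℕ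))

-- `GlueSpec` holds: proved by `Summit.ABC.ABC.Theorems.padicPrincipalCoreRadThree_glueSpec_proof` @ f4e04128897f (its module imports this route file, so no `_holds` link can be stated here).

/-- item stmt-ABC-19895 · support · rank 9 · closed · proved by Summit.ABC.ABC.Theorems.padicPrincipalCoreRadThree_oddKappaDoorSpec_proof @ f4e04128897f (prover) · by planner
sources: StewartYu1991, StewartTijdeman1986
[support] The κ-door at the odd places: the one-prime bound with σ ≤ 2 at every ODD prime (any K ≥
0, L ≥ 1, κ ≥ 0) gives EpsShapeBound (max 1 κ), i.e. log c ≪_ε rad^(max(1,κ)+ε) — two odd p-adic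
routes through the max-ord device and Lemma 4 (Chebyshev) of Stewart–Yu 1991 on S minus the top
prime of the route, plus Waldschmidt's archimedean route when a < √b. Proved in staging
(`Summit.ABC.StewartYu.KappaDoor.epsShape_of_oddFinBound`, files KappaDoorAlgebra/KappaDoorSlot
landed, K2–K4 staged). [difficulty: provable-now] -/
@[route_item "route-ABC-PadicPrincipalCoreRadThree", crux]
def OddKappaDoorSpec : Prop :=
  ∀ (K L κ σ : ℝ) (τ τ₁ : ℕ), 0 ≤ K → 1 ≤ L → 0 ≤ κ → 0 ≤ σ → σ ≤ 2 → (∀ p, p.Prime → p ≠ 2 → (∀ (n : ℕ) (q : Fin n → ℕ) (e : Fin n → ℤ), (∀ i, (q i).Prime) → Function.Injective q → (∀ i, q i ≠ p) → e ≠ 0 → ∏ i, ((q i : ℚ)) ^ e i ≠ 1 → (padicValRat p (∏ i, ((q i : ℚ)) ^ e i - 1) : ℝ) ≤ K * L ^ n * (n : ℝ) ^ (κ * n) * (p : ℝ) ^ σ * (∏ i, Real.log (q i)) * Real.log (max 3 ((Finset.univ.sup fun i => (e i).natAbs : ℕ) : ℝ)) ^ τ * Real.log (max 3 (∏ i, ((q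 i : ℕ) : ℝ))) ^ τ₁)) → Literature.Barriers.ABC.EpsShapeBound (max 1 κ)

-- `OddKappaDoorSpec` holds: proved by `Summit.ABC.ABC.Theorems.padicPrincipalCoreRadThree_oddKappaDoorSpec_proof` @ f4e04128897f (its module imports this route file, so no `_holds` link can be stated here).

/-- item stmt-ABC-19896 · assembly · rank 1 · closed · proved by Summit.ABC.ABC.Theorems.padicPrincipalCoreRadThree_assembly_proof @ f4e04128897f (prover) · by planner
sources: StewartYu1991
[assembly] TheoremAOne → WPM → GlueSpec → OddKappaDoorSpec → EpsShapeBoundThree (the rung leaf,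
`closes_target`; EpsShapeBoundFour follows by `epsShapeBoundFour_of_three`). -/
@[route_item "route-ABC-PadicPrincipalCoreRadThree"]
def Assembly : Prop :=
  TheoremAOne → WPM → GlueSpec → OddKappaDoorSpec → Literature.Barriers.ABC.EpsShapeBoundThree

-- `Assembly` holds: proved by `Summit.ABC.ABC.Theorems.padicPrincipalCoreRadThree_assembly_proof` @ f4e04128897f (its module imports this route file, so no `_holds` link can be stated here).

/-! D-0027 §2.1 — DECIDING THEOREM (planner-authored via `route open/edit --closes-file`; by planner-abc-stewartyu-plan-g2-0 2026-08-25T22:55:17Z) — ARCHIVED: route closed (proved) 2026-08-26T13:16:26Z; kept so importers keep building: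
its hypotheses are this route's items and its conclusion the registered leaf `Literature.Barriers.ABC.EpsShapeBoundThree` (rung F-A1.M1⁺(3), D-0061) (glue_lint), and it elaborates with this file. -/

@[closes "route-ABC-PadicPrincipalCoreRadThree"] theorem closes (hA : TheoremAOne) (hM : WPM) (hG : GlueSpec) (hO : OddKappaDoorSpec) :
    Literature.Barriers.ABC.EpsShapeBoundThree := by
  obtain ⟨C, r, c₁, c₂, hc₁, hc₂, hc₂1, hC, hB⟩ := hA
  obtain ⟨K, L, κ, hK, hL, hκ0, hκ, h⟩ := hG hM C r c₁ c₂ hc₁ hc₂ hC hB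
  exact Literature.Barriers.ABC.epsShapeBound_mono (max_le (by norm_num) (by linarith))
    (hO K L κ 2 2 2 hK hL hκ0 (by norm_num) le_rfl h)

end Summit.ABC.ABC.Theses.PadicPrincipalCoreRadThree
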